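import Mathlib
import Summits.NavierStokesRegularity.NavierStokesRegularity.Theses.StretchingWellBinding
import HarnessLib

/-!
# `StretchingWellBinding.Assembly` — the route's assembly (item stmt-NavierStokesRegularity-10678;
  pure logic)

**Statement.** `EnstrophyQuarterLaw → NoLocalTypeISingularity → TypeIBridge → NoBlowupToClay →
NavierStokesRegularity`.

PROOF. NoBlowup holds: a putative maximal solution obeys the enstrophy quarter law, the Type-I bridge
turns it into a local Type-I singular point, which `NoLocalTypeISingularity` forbids; `NoBlowupToClay`
concludes.

HONEST FRAMING: glue between the route's own statements; nothing here bears on the regularity problem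
itself.
-/

noncomputable section

set_option linter.dupNamespace false

namespace Summit.NavierStokesRegularity.NavierStokesRegularity.Theorems

/-- **Item stmt-NavierStokesRegularity-10678** (`StretchingWellBinding.Assembly`). [this file] -/
theorem stretchingWellBinding_assembly_proof :
    Summit.NavierStokesRegularity.NavierStokesRegularity.Theses.StretchingWellBinding.Assembly := by
  unfold Summit.NavierStokesRegularity.NavierStokesRegularity.Theses.StretchingWellBinding.Assembly
    Summit.NavierStokesRegularity.NavierStokesRegularity.Theses.StretchingWellBinding.EnstrophyQuarterLaw
    Summit.NavierStokesRegularity.NavierStokesRegularity.Theses.StretchingWellBinding.NoLocalTypeISingularity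
    Summit.NavierStokesRegularity.NavierStokesRegularity.Theses.StretchingWellBinding.TypeIBridge
    Summit.NavierStokesRegularity.NavierStokesRegularity.Theses.StretchingWellBinding.NoBlowupToClay
  intro hEQL hNo hBridge hNBC
  refine hNBC fun ν T hν hT u p hcl hLH hdec => ?_
  by_contra hext
  have hmax : Literature.Analysis.FluidPDE.IsMaximalSmoothSolution ν 0 u p T := ⟨hcl, hext⟩
  exact hNo (hBridge ν T hν hT u p hmax hLH hdec (hEQL ν T hν hT u p hmax hLH hdec))

end Summit.NavierStokesRegularity.NavierStokesRegularity.Theorems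

end
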